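/-
Copyright (c) 2026 the pub-hodgecm-mathlib formalisation cell (harness21).  Prover seat hodgecm-mathlib-K2E2-p12 (g9), Track B «K2-LIT», h413 = `stmt-HodgeConjecture-24833`,
R90-TF section S8 «ContSpec-n½», deal S8-R179 ∕ S8-R183 (1) (S8 dealer R90-CS-plan (g3); census `R90/S8/CENSUS-PoleLedger.K2E2-p12-g9.md` 4b9dd189ca38c4d5): THE χ POLE LEDGER —
D1's clauses `Sp hSp hEd Fp hF hFE` at the middle pole `3∕2` for the EXPORTED continuation `Ec` of a pair-section Eisenstein family of `U(2,1)_{L∕L⁺}`, HYPOTHESIS-FIRST on the two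
pointwise boundedness letters (fake poles ∕ the middle pole) that the Maass–Selberg road pays.
-/
import Summits.HodgeConjecture.HodgeConjecture.Theorems.K2E1SphericalEisensteinRegularRemainderCMThreeOfLetters   -- ★ (K2E4-p10) generic bricks (c): `exists_analyticAt_eventuallyEq_of_meromorphicAt_of_eventually_norm_le`; brings ★ `K2E1BLRemovablePolesU` (`MeromorphicNFAt.analyticAt_of_eventually_norm_le`, `analyticAt_toMeromorphicNFAt_of_eventually_norm_le`)
import Summits.HodgeConjecture.HodgeConjecture.Theorems.R90S8ResGMidAtomArchStableU3                                 -- ★ p863205 (K2E1-p11): `midContinuation_quotientSubgroup_mul` (`hEcinv` from D1's clauses); brings ★ D1 `resGMidAtomGen`, ★ `IsChiSectionPair`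
import HarnessLib

/-!
# h413 ∕ R90-S8 — `K2E1ChiEisensteinPoleLedgerCMThree`: THE χ POLE LEDGER AT THE MIDDLE POLE — D1's clauses `Sp := {3∕2}`, `hSp`, `hEd`, `Fp`, `hF`, `hFE` FOR THE EXPORTED
# CONTINUATION `Ec`, OF LETTERS (the two pointwise boundedness inputs of the Maass–Selberg road)

Cell `pub/hodgecm-mathlib`, crux H413 = `stmt-HodgeConjecture-24833`, route `HCCMUnconditional`; R90-TF section S8, the POLE-LEDGER row `Sp hSp hSpP Fp hF hFE` of the (V)∕(R) «OF RECORD»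
files (S8-R179: K2E1-p15 `R90S8ResGMidBlockNeBotOfRecordU3`, K2E1-p12 (R)′).  THEOREMS ONLY (no `def`, no `instance`, no notation, no named-fact hypothesis, no `sorry`; default heartbeats);
lane `--supports stmt-HodgeConjecture-24833 --as helper` (count-neutral).  Closes no socket.

THE MATHEMATICS ([MoeglinWaldspurger1995, IV.1.9–IV.1.11, IV.3.12]; [BernsteinLapid2019, Thm 2.3, §4]).  The ★ exports (`chiEisenstein_meromorphic_exports_*_cm_three`, ★ p863748 at the
witness block) deliver the continued point values `Ec` of `z ↦ E(φ_z)` in MEROMORPHIC NORMAL FORM in `z` for every `g` (`MeromorphicNFOn (Ec · g) univ`), analytic off a closed-discrete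
candidate pole set `P ⊆ {Re ≤ 2}`, with `Ec z = E(φ_z)` on the tube.  ★ D1 `resGMidAtomGen` wants MORE: a FINITE REAL `Sp ⊂ (1,2]` with `Ec · g` holomorphic on the slit half-plane
`{1 < Re} ∖ Sp`, and a POLE LETTER `Fp` at `3∕2` (`Fp g` analytic at `3∕2`, `= (z − 3∕2)·Ec z g` nearby — pole order ≤ 1).  By Riemann's removable-singularity theorem IN NORMAL FORM (★
`MeromorphicNFAt.analyticAt_of_eventually_norm_le`: a function in normal form that is BOUNDED near `z₀` is analytic AT `z₀` — no redefinition needed), this is EXACTLY two pointwise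
boundedness statements: (B-P) `Ec · g` is bounded on a punctured neighbourhood of every candidate pole `z₀ ∈ P`, `1 < Re z₀`, `z₀ ≠ 3∕2` («the fake poles are removable»); (B-3∕2)
`(z − 3∕2)·Ec z g` is bounded on a punctured neighbourhood of `3∕2` («the middle pole is at most simple»; then `Fp g :=` the normal form of `(z − 3∕2)·Ec z g`, ★
`exists_analyticAt_eventuallyEq_of_meromorphicAt_of_eventually_norm_le`).  So `Sp := {3∕2}`.  WHO PAYS (B-P), (B-3∕2) (census 4b9dd189ca38c4d5, S8-R183): the `L²` bounds of the
operator road's truncated family — (MS-3∕2) `‖(z − 3∕2)•Fam z‖ ≤ C` near `3∕2` (★ p862829 `msBound_middlePole_of_chiRelation` ∘ ★ p862892 `msRel_of_tube_letters` ∘ ★ p863423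
`chiTube_threeScalars_uniform_free`, K2E1-p16's (L4) composition) and (MS-P′) `‖Fam z‖ ≤ C` near every other candidate pole (OFF the real axis: p16 lineage (T2)∕(T3); ON the real axis
`(1,2) ∖ {3∕2}`: the R7₃ real ledger «poles of `Ec` on the real segment ⊆ poles of the scalar `qc`» [MW95 IV.3.12 (b)], scalar half ★ F4∕F5, `Ec` half L — UNOWNED) — CARRIED TO POINT
VALUES by (a′) «an eventual `L²` bound of `w(z)•Fam z` gives an eventual pointwise bound of `w(z)·Ec z g`» at level `(K′, ω)` (the (E5) core's evaluation functionals, Banach–Steinhaus as in ★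
p863548, whose natural output is UNIFORM on compacts in `g`; K2E1-p16 after (C3), S–M).
THE LAYER-2 ROWS `hE4 hEbd` OF ★ p863385 ON `{1 < Re} ∖ {3∕2}` (§2–§3).  The exports print (E4) and (E2-bd) only OFF `P`; a removable candidate pole `z₀` is still a member of `P`, so the
restriction-by-inclusion `{1<Re} ∖ Sp ⊆ Pᶜ` (★ `chiPair_rowsEdE4Ebd_of_poleLedger`'s `hSpP`) is NOT available at `Sp := {3∕2}` — and a per-`g` bound does not give continuity in `g` at
`z₀` (Osgood).  What does: the JOINT form (B-P-K) of the letter — `Ec` bounded on a punctured neighbourhood of `z₀` UNIFORMLY for `g` in a compact — which is exactly what (a′)'s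
Banach–Steinhaus step produces.  §2 is the soft analysis, for any topological parameter space: the value at `z₀` obeys the same bound (limit along the punctured filter), and `g ↦ Ec z₀ g`
is continuous — SCHWARZ'S LEMMA (`Complex.dist_le_div_mul_dist_of_mapsTo_ball`) makes the removed family `{Ec · g}_{g ∈ K}` equi-Lipschitz in `z` on a small disc, so the continuity of
`Ec z₂ ·` at a nearby NON-pole `z₂` passes to `z₀` (an `ε∕3` argument; `G(𝔸)` is locally compact).  §3 assembles ALL of ★ p863385's row (i) at `Sp := {3∕2}`.
* §1 **`chiEisenstein_poleLedger_cm_three_of_letters`** — `(hSp) ∧ (hEd) ∧ ∃ Fp, (hF) ∧ (hFE)` at `Sp := {3∕2}`, from `hEnf`, `hEan` (★ exports' clauses) and the per-`g` letters (B-P),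
  (B-3∕2); **`hEcinv_of_poleLedger`** — left-`G(F)`-invariance of `Ec` on `{1<Re} ∖ {3∕2}` for a pair section of D1's block (★ p863205 on the ledger's `hEd`).
* §2 (generic, any parameter space) **`norm_le_at_removable_of_joint_bound`**, **`locally_bounded_at_removable_of_joint_bound`**, **`continuous_at_removable_of_joint_bound`** (Schwarz);
  **`meromorphicNFOn_twist`** (normal form survives a unit twist `Ec·Θ` — restores the NF clause at the pair block, ★ `chiPair_exports_of_witness`).
* §3 **`chiEisenstein_jointRows_cm_three_of_letters`** — `hE4`, `hEbd` on `{1<Re} ∖ {3∕2}` from the exports' `Pᶜ`-rows, co-discreteness of `P`, `hEnf`, and (B-P-K); HEAD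
  **`chiEisenstein_poleLedger_rows_cm_three_of_letters`** — ★ p863385's row (i) `hSp hEd hF hFE hE4 hEbd` at `Sp := {3∕2}` from the exports' clauses and the two letters (B-P-K), (B-3∕2).
HONEST LABEL: HC_CM is proved only modulo the 7 printed citations (2 remaining named inputs: hLiu418 = `stmt-HodgeConjecture-24832`, h413 = `stmt-HodgeConjecture-24833`) until rung 0
closes; this file asserts no named fact and closes no socket; conditional by construction on the visible letters (B-P)∕(B-P-K) and (B-3∕2) — paid by nobody tonight ((a′) S–M p16,
(MS-P′) off-axis M p16, R7₃ on-axis L unowned); count-neutral.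

## References
* [MoeglinWaldspurger1995] C. Mœglin, J.-L. Waldspurger, *Spectral Decomposition and Eisenstein Series* (1995), IV.1.9–IV.1.11, IV.3.12.
* [BernsteinLapid2019] J. Bernstein, E. Lapid, *On the meromorphic continuation of Eisenstein series*, J. AMS 37 (2024), Thm 2.3, §4 p. 10.
* [Langlands1976] R. P. Langlands, *On the Functional Equations Satisfied by Eisenstein Series*, LNM 544 (1976), §7.
* [Conway1978] J. B. Conway, *Functions of One Complex Variable I*, 2nd ed. (1978), V §1 (removable singularities), VI §2 (Schwarz's lemma).
-/

set_option autoImplicit false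
set_option linter.dupNamespace false  -- the mandated namespace repeats the summit's segment (`HodgeConjecture.HodgeConjecture`)

noncomputable section

open MeasureTheory Measure NumberField IsDedekindDomain Set Filter Topology
open scoped ENNReal NNReal
open Literature.NumberTheory.Automorphic Literature.NumberTheory.Automorphic.UnitaryGroup Literature.NumberTheory.GaloisRepresentations AdelicGroupData
open Literature.NumberTheory.Automorphic.Arthur2013.Leaves.TECR Literature.NumberTheory.Rogawski1990
open Summit.HodgeConjecture.HodgeConjecture.Cruxes.H413.K2E1BorelEisensteinU
open Summit.HodgeConjecture.HodgeConjecture.Cruxes.H413.K2E1CharacterEisensteinU3PairDefs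
open Summit.HodgeConjecture.HodgeConjecture.Cruxes.H413.K2E1ChiSectionSpaceU3PairDefs
open Summit.HodgeConjecture.HodgeConjecture.Cruxes.H413.K2E1SphericalEisensteinRegularRemainderCMThreeOfLetters (exists_analyticAt_eventuallyEq_of_meromorphicAt_of_eventually_norm_le)
open Summit.HodgeConjecture.HodgeConjecture.R90.S8 (midContinuation_quotientSubgroup_mul)

namespace Summit.HodgeConjecture.HodgeConjecture.Cruxes.H413.K2E1ChiEisensteinPoleLedgerCMThree

variable (L : Type) [Field L] [NumberField L] [IsCMField L]

/-! ## §1 The ledger at `Sp := {3∕2}` from the two pointwise boundedness letters -/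

section Ledger

/-- **THE χ POLE LEDGER, OF LETTERS** (D1's clauses for the exported `Ec`, `Sp := {3∕2}`): for `Ec : ℂ → G(𝔸) → ℂ` in MEROMORPHIC NORMAL FORM in `z` for every `g` (★ exports' clause
`hEnf`) and analytic off the candidate pole set `P` (`hEan`), IF (B-P) `Ec · g` is bounded on a punctured neighbourhood of every `z₀ ∈ P` with `1 < Re z₀`, `z₀ ≠ 3∕2`, AND (B-3∕2)
`(z − 3∕2)·Ec z g` is bounded on a punctured neighbourhood of `3∕2`, THEN: `Sp := {3∕2}` is a finite set of real points of `(1, 2]`; `Ec · g` is holomorphic on `{1 < Re} ∖ {3∕2}` for every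
`g` (removable singularities IN NORMAL FORM are not singularities, ★ `MeromorphicNFAt.analyticAt_of_eventually_norm_le`); and there is a pole letter `Fp` at `3∕2` (the normal form of
`(z − 3∕2)·Ec z g`, ★ `exists_analyticAt_eventuallyEq_of_meromorphicAt_of_eventually_norm_le`).  (`hE2` passes through unchanged — `Ec` is NOT redefined.)
[cite: MoeglinWaldspurger1995, IV.1.9–IV.1.11] [cite: BernsteinLapid2019, Thm 2.3] -/
theorem chiEisenstein_poleLedger_cm_three_of_letters
    (Ec : ℂ → (quasiSplit (↥(maximalRealSubfield L)) L (IsCMField.complexConj L) 3).Adelic → ℂ) (P : Set ℂ)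
    (hEnf : ∀ g, MeromorphicNFOn (fun z => Ec z g) univ)
    (hEan : ∀ g (z : ℂ), z ∉ P → AnalyticAt ℂ (fun z => Ec z g) z)
    -- (B-P): the fake poles are removable (pointwise boundedness near every candidate pole of `{1 < Re}` other than `3∕2`)
    (hbddP : ∀ g, ∀ z₀ ∈ P, 1 < z₀.re → z₀ ≠ (3 : ℂ) / 2 → ∃ C : ℝ, ∀ᶠ z in 𝓝[≠] z₀, ‖Ec z g‖ ≤ C)
    -- (B-3∕2): the middle pole is at most simple
    (hbdd32 : ∀ g, ∃ C : ℝ, ∀ᶠ z in 𝓝[≠] ((3 : ℂ) / 2), ‖(z - (3 : ℂ) / 2) * Ec z g‖ ≤ C) :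
    (∀ s ∈ (({(3 : ℂ) / 2} : Finset ℂ)), s.im = 0 ∧ 1 < s.re ∧ s.re ≤ 2) ∧
      (∀ g, DifferentiableOn ℂ (fun z => Ec z g) ({z : ℂ | 1 < z.re} \ (↑({(3 : ℂ) / 2} : Finset ℂ) : Set ℂ))) ∧
      ∃ Fp : (quasiSplit (↥(maximalRealSubfield L)) L (IsCMField.complexConj L) 3).Adelic → ℂ → ℂ,
        (∀ g, AnalyticAt ℂ (Fp g) ((3 : ℂ) / 2)) ∧ (∀ g, Fp g =ᶠ[𝓝[≠] ((3 : ℂ) / 2)] fun z => (z - (3 : ℂ) / 2) * Ec z g) := by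
  refine ⟨fun s hs => ?_, fun g z hz => ?_, ?_⟩
  · -- `Sp = {3∕2}` is real, in `(1, 2]`
    rw [Finset.mem_singleton] at hs
    subst hs
    refine ⟨by norm_num, by norm_num, by norm_num⟩
  · -- holomorphy on the slit half-plane: off `P` by `hEan`, at a candidate pole by normal form + (B-P)
    have hz32 : z ≠ (3 : ℂ) / 2 := fun h => hz.2 (by rw [h]; simp)
    by_cases hzP : z ∈ P
    · exact (((hEnf g) (Set.mem_univ z)).analyticAt_of_eventually_norm_le (hbddP g z hzP hz.1 hz32)).differentiableAt.differentiableWithinAt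
    · exact (hEan g z hzP).differentiableAt.differentiableWithinAt
  · -- the pole letter at `3∕2`: the normal form of the meromorphic, bounded `(z − 3∕2)·Ec z g`
    have hmer : ∀ g, MeromorphicAt (fun z : ℂ => (z - (3 : ℂ) / 2) * Ec z g) ((3 : ℂ) / 2) := fun g =>
      ((analyticAt_id.sub analyticAt_const).meromorphicAt).mul ((hEnf g) (Set.mem_univ _)).meromorphicAt
    refine ⟨fun g => Classical.choose (exists_analyticAt_eventuallyEq_of_meromorphicAt_of_eventually_norm_le (hmer g) (hbdd32 g)),
      fun g => (Classical.choose_spec (exists_analyticAt_eventuallyEq_of_meromorphicAt_of_eventually_norm_le (hmer g) (hbdd32 g))).1,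
      fun g => (Classical.choose_spec (exists_analyticAt_eventuallyEq_of_meromorphicAt_of_eventually_norm_le (hmer g) (hbdd32 g))).2⟩

/-- **`hEcinv` ON THE LEDGER'S SLIT PLANE** for a pair section of D1's block: with `Sp := {3∕2}` and the ledger's holomorphy `hEd`, the exported continuation of `E(φ_z)`, `φ ∈
V(ξ.bcη⁻¹·ξ.bcψ⁻¹·μω, ξ.ψ; K′, ω)`, is left-`G(F)`-invariant on `{1 < Re} ∖ {3∕2}` (★ p863205 `midContinuation_quotientSubgroup_mul`; `ξ.ψ` automorphic). [cite: MoeglinWaldspurger1995, II.1.5, IV.1.11] -/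
theorem hEcinv_of_poleLedger (ξ : OneDimAutRepH L) (μω : HeckeCharacter L)
    {K' : Subgroup (quasiSplit (↥(maximalRealSubfield L)) L (IsCMField.complexConj L) 3).Adelic} {ω : ↥K' → ℂ}
    {φ : (quasiSplit (↥(maximalRealSubfield L)) L (IsCMField.complexConj L) 3).Adelic → ℂ} (hφ : φ ∈ chiSectionSpacePair (ξ.bcη⁻¹ * ξ.bcψ⁻¹ * μω) ξ.ψ K' ω)
    {Ec : ℂ → (quasiSplit (↥(maximalRealSubfield L)) L (IsCMField.complexConj L) 3).Adelic → ℂ}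
    (hEd : ∀ g, DifferentiableOn ℂ (fun z => Ec z g) ({z : ℂ | 1 < z.re} \ (↑({(3 : ℂ) / 2} : Finset ℂ) : Set ℂ)))
    (hE2 : ∀ z : ℂ, 2 < z.re → Ec z = eisensteinSeriesU (flatSectionU φ z)) :
    ∀ z ∈ ({z : ℂ | 1 < z.re} \ (↑({(3 : ℂ) / 2} : Finset ℂ) : Set ℂ)),
      ∀ (γ : (quasiSplit (↥(maximalRealSubfield L)) L (IsCMField.complexConj L) 3).arithmeticSubgroup) (x : (quasiSplit (↥(maximalRealSubfield L)) L (IsCMField.complexConj L) 3).Adelic),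
        Ec z ((γ : (quasiSplit (↥(maximalRealSubfield L)) L (IsCMField.complexConj L) 3).Adelic) * x) = Ec z x := fun z hz γ x =>
  midContinuation_quotientSubgroup_mul L (isChiSectionPair_of_mem hφ) ξ.hψ (fun s hs => by rw [Finset.mem_singleton] at hs; subst hs; norm_num) hEd hE2
    ((quasiSplit (↥(maximalRealSubfield L)) L (IsCMField.complexConj L) 3).arithmeticSubgroup_le_quotientSubgroup γ.2) x hz

end Ledger

/-! ## §2 Joint removability: the value bound and the continuity in the parameter at a removed point (generic) -/

section Generic

variable {X : Type*}

/-- **THE VALUE AT A REMOVED POINT OBEYS THE PUNCTURED BOUND**: if `z ↦ E z g` is continuous at `z₁` and `‖E z g‖ ≤ C` on a punctured neighbourhood of `z₁`, then `‖E z₁ g‖ ≤ C`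
(limit along the punctured filter, which is non-trivial in `ℂ`). [cite: Conway1978, V §1] -/
theorem norm_le_at_removable_of_joint_bound (E : ℂ → X → ℂ) {z₁ : ℂ} {g : X} (hc : ContinuousAt (fun z => E z g) z₁) {C : ℝ}
    (hC : ∀ᶠ z in 𝓝[≠] z₁, ‖E z g‖ ≤ C) : ‖E z₁ g‖ ≤ C :=
  le_of_tendsto ((hc.norm.tendsto).mono_left nhdsWithin_le_nhds) hC

/-- **(E2-bd) AT A REMOVED POINT**: a bound on a punctured neighbourhood of `z₁`, uniform for `g ∈ K`, together with continuity of every `z ↦ E z g` (`g ∈ K`) at `z₁`, is a bound on a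
full neighbourhood of `z₁`, uniform for `g ∈ K`. [cite: Conway1978, V §1] -/
theorem locally_bounded_at_removable_of_joint_bound (E : ℂ → X → ℂ) {z₁ : ℂ} {K : Set X} (hc : ∀ g ∈ K, ContinuousAt (fun z => E z g) z₁)
    (hbd : ∃ C : ℝ, ∀ᶠ z in 𝓝[≠] z₁, ∀ g ∈ K, ‖E z g‖ ≤ C) : ∃ V ∈ 𝓝 z₁, ∃ M : ℝ, ∀ z ∈ V, ∀ g ∈ K, ‖E z g‖ ≤ M := by
  obtain ⟨C, hC⟩ := hbd
  refine ⟨{z : ℂ | z ≠ z₁ → ∀ g ∈ K, ‖E z g‖ ≤ C}, eventually_nhdsWithin_iff.1 hC, C, fun z hz g hg => ?_⟩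
  by_cases hzz : z = z₁
  · subst hzz
    exact norm_le_at_removable_of_joint_bound E (hc g hg) (hC.mono fun w hw => hw g hg)
  · exact hz hzz g hg

/-- **(E4) AT A REMOVED POINT, BY SCHWARZ'S LEMMA** (`X` weakly locally compact): suppose every `z ↦ E z g` is analytic at `z₁`; on a punctured neighbourhood of `z₁` every `z ↦ E z g` is
differentiable and every `E z` is continuous on `X`; and for every compact `K ⊆ X`, `E` is bounded on a punctured neighbourhood of `z₁` uniformly for `g ∈ K`.  Then `E z₁` is continuous.
PROOF: on a small ball `B(z₁, r)` the family `{E · g}_{g ∈ K}` (`K` a compact neighbourhood of `g₀`) is holomorphic and bounded by `C`, so by Schwarz's lemma `|E z g − E z₁ g| ≤ (2C∕r)|z − z₁|`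
uniformly in `g ∈ K`; pick a non-pole `z₂` close to `z₁` and use the continuity of `E z₂` at `g₀` (`ε∕3`). [cite: Conway1978, VI §2] [cite: BernsteinLapid2019, §4 p. 10] -/
theorem continuous_at_removable_of_joint_bound [TopologicalSpace X] [WeaklyLocallyCompactSpace X] (E : ℂ → X → ℂ) {z₁ : ℂ} (han₁ : ∀ g, AnalyticAt ℂ (fun z => E z g) z₁)
    (han : ∀ᶠ z in 𝓝[≠] z₁, (∀ g, DifferentiableAt ℂ (fun w => E w g) z) ∧ Continuous (E z))
    (hbd : ∀ K : Set X, IsCompact K → ∃ C : ℝ, ∀ᶠ z in 𝓝[≠] z₁, ∀ g ∈ K, ‖E z g‖ ≤ C) : Continuous (E z₁) := by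
  refine continuous_iff_continuousAt.2 fun g₀ => ?_
  obtain ⟨K, hK, hKg₀⟩ := exists_compact_mem_nhds g₀
  have hg₀K : g₀ ∈ K := mem_of_mem_nhds hKg₀
  obtain ⟨C, hC⟩ := hbd K hK
  -- a radius `r` such that the punctured ball carries differentiability, continuity in `g`, and the joint bound
  obtain ⟨r, hr, hball⟩ : ∃ r > 0, ∀ z : ℂ, dist z z₁ < r → z ≠ z₁ → ((∀ g, DifferentiableAt ℂ (fun w => E w g) z) ∧ Continuous (E z)) ∧ ∀ g ∈ K, ‖E z g‖ ≤ C := by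
    have h := han.and hC
    rw [eventually_nhdsWithin_iff, Metric.eventually_nhds_iff] at h
    obtain ⟨r, hr, h⟩ := h
    exact ⟨r, hr, fun z hz hne => h hz hne⟩
  -- the bound at the centre, for `g ∈ K`
  have hval : ∀ g ∈ K, ‖E z₁ g‖ ≤ C := fun g hg =>
    norm_le_at_removable_of_joint_bound E (han₁ g).continuousAt (hC.mono fun w hw => hw g hg)
  -- Schwarz: the removed family is equi-Lipschitz at `z₁` on `B(z₁, r)`
  have hlip : ∀ g ∈ K, ∀ z ∈ Metric.ball z₁ r, dist (E z g) (E z₁ g) ≤ 2 * C / r * dist z z₁ := fun g hg z hz => by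
    refine Complex.dist_le_div_mul_dist_of_mapsTo_ball (f := fun w => E w g) (fun w hw => ?_) (fun w hw => ?_) hz
    · by_cases hw₁ : w = z₁
      · subst hw₁; exact (han₁ g).differentiableAt.differentiableWithinAt
      · exact ((hball w (Metric.mem_ball.1 hw) hw₁).1.1 g).differentiableWithinAt
    · rw [Metric.mem_closedBall, dist_eq_norm]
      by_cases hw₁ : w = z₁
      · subst hw₁; rw [sub_self, norm_zero]; linarith [norm_nonneg (E w g), hval g hg]
      · calc ‖E w g - E z₁ g‖ ≤ ‖E w g‖ + ‖E z₁ g‖ := norm_sub_le _ _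
          _ ≤ C + C := add_le_add ((hball w (Metric.mem_ball.1 hw) hw₁).2 g hg) (hval g hg)
          _ = 2 * C := by ring
  -- the `ε ∕ 3` argument
  rw [Metric.continuousAt_iff']
  intro ε hε
  obtain ⟨z₂, ⟨hz₂r, hz₂ne⟩, hz₂ε⟩ : ∃ z₂ : ℂ, (z₂ ∈ Metric.ball z₁ r ∧ z₂ ≠ z₁) ∧ 2 * C / r * dist z₂ z₁ < ε / 3 := by
    have h1 : ∀ᶠ z in 𝓝[≠] z₁, z ∈ Metric.ball z₁ r ∧ z ≠ z₁ := by
      filter_upwards [mem_nhdsWithin_of_mem_nhds (Metric.ball_mem_nhds z₁ hr), self_mem_nhdsWithin] with z hz hne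
      exact ⟨hz, hne⟩
    have h2 : Tendsto (fun z : ℂ => 2 * C / r * dist z z₁) (𝓝[≠] z₁) (𝓝 0) := by
      have h : Tendsto (fun z : ℂ => 2 * C / r * dist z z₁) (𝓝 z₁) (𝓝 (2 * C / r * dist z₁ z₁)) :=
        ((continuous_id.dist continuous_const).tendsto z₁).const_mul (2 * C / r)
      rw [dist_self, mul_zero] at h
      exact h.mono_left nhdsWithin_le_nhds
    exact (h1.and (h2.eventually_lt_const (by linarith : (0 : ℝ) < ε / 3))).exists
  have hcont₂ : ∀ᶠ g in 𝓝 g₀, dist (E z₂ g) (E z₂ g₀) < ε / 3 :=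
    Metric.continuousAt_iff'.1 (hball z₂ (Metric.mem_ball.1 hz₂r) hz₂ne).1.2.continuousAt (ε / 3) (by linarith)
  filter_upwards [hcont₂, hKg₀] with g hg hgK
  calc dist (E z₁ g) (E z₁ g₀) ≤ dist (E z₁ g) (E z₂ g) + dist (E z₂ g) (E z₂ g₀) + dist (E z₂ g₀) (E z₁ g₀) := dist_triangle4 _ _ _ _
    _ < ε / 3 + ε / 3 + ε / 3 := by
        have h1 : dist (E z₁ g) (E z₂ g) < ε / 3 := by rw [dist_comm]; exact (hlip g hgK z₂ hz₂r).trans_lt hz₂ε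
        have h3 : dist (E z₂ g₀) (E z₁ g₀) < ε / 3 := (hlip g₀ hg₀K z₂ hz₂r).trans_lt hz₂ε
        linarith
    _ = ε := by ring

/-- **NORMAL FORM SURVIVES A UNIT TWIST**: if every `z ↦ E z g` is in meromorphic normal form on `ℂ`, so is every `z ↦ E z g · Θ(g)` for a unit-valued `Θ` (Mathlib's
`meromorphicNFAt_mul_iff_left` with the non-vanishing constant `Θ g`) — restores the exports' NF clause at the det-twisted pair block `Ec·Θ`. [cite: MoeglinWaldspurger1995, IV.1.9] -/
theorem meromorphicNFOn_twist (E : ℂ → X → ℂ) (hE : ∀ g, MeromorphicNFOn (fun z => E z g) univ) (Θ : X → ℂˣ) :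
    ∀ g, MeromorphicNFOn (fun z => E z g * ((Θ g : ℂˣ) : ℂ)) univ := fun g _ hz =>
  (meromorphicNFAt_mul_iff_left (f := fun z => E z g) (g := fun _ : ℂ => ((Θ g : ℂˣ) : ℂ)) analyticAt_const (Units.ne_zero _)).2 (hE g hz)

end Generic

/-! ## §3 The layer-2 rows `hE4 hEbd` on `{1 < Re} ∖ {3∕2}` and ★ p863385's full row (i) at `Sp := {3∕2}` -/

section Rows

/-- **THE ROWS `hE4 hEbd` ON THE LEDGER'S SLIT PLANE, OF THE JOINT LETTER**: from the exports' clauses for `Ec` — normal form in `z` (`hEnf`), co-discreteness of the candidate pole set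
`P` (`hPcd`), analyticity (`hEan`), (E4) and (E2-bd) OFF `P` — and the JOINT letter (B-P-K) «at every candidate pole `z₀ ∈ P` with `1 < Re z₀`, `z₀ ≠ 3∕2`, `Ec` is bounded on a punctured
neighbourhood of `z₀` uniformly for `g` in any compact»: (E4) and (E2-bd) hold at EVERY point of `{1 < Re} ∖ {3∕2}` (§2: at the removed points by the limit bound and Schwarz's lemma;
`G(𝔸)` locally compact). [cite: MoeglinWaldspurger1995, IV.1.9–IV.1.11] [cite: BernsteinLapid2019, §4 p. 10] -/
theorem chiEisenstein_jointRows_cm_three_of_letters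
    (Ec : ℂ → (quasiSplit (↥(maximalRealSubfield L)) L (IsCMField.complexConj L) 3).Adelic → ℂ) (P : Set ℂ)
    (hEnf : ∀ g, MeromorphicNFOn (fun z => Ec z g) univ) (hPcd : ∀ z₀ : ℂ, ∀ᶠ s in 𝓝[≠] z₀, s ∉ P)
    (hEan : ∀ g (z : ℂ), z ∉ P → AnalyticAt ℂ (fun z => Ec z g) z) (hE4 : ∀ z : ℂ, z ∉ P → Continuous (Ec z))
    (hEbd : ∀ z₁ : ℂ, z₁ ∉ P → ∀ K : Set (quasiSplit (↥(maximalRealSubfield L)) L (IsCMField.complexConj L) 3).Adelic, IsCompact K → ∃ V ∈ 𝓝 z₁, ∃ M : ℝ, ∀ z ∈ V, ∀ g ∈ K, ‖Ec z g‖ ≤ M)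
    -- (B-P-K): the fake poles are removable, jointly (punctured bound near every candidate pole of `{1 < Re}` other than `3∕2`, uniform on compacts in `g`)
    (hbddPK : ∀ z₀ ∈ P, 1 < z₀.re → z₀ ≠ (3 : ℂ) / 2 → ∀ K : Set (quasiSplit (↥(maximalRealSubfield L)) L (IsCMField.complexConj L) 3).Adelic, IsCompact K →
      ∃ C : ℝ, ∀ᶠ z in 𝓝[≠] z₀, ∀ g ∈ K, ‖Ec z g‖ ≤ C) :
    (∀ z ∈ ({z : ℂ | 1 < z.re} \ (↑({(3 : ℂ) / 2} : Finset ℂ) : Set ℂ)), Continuous (Ec z)) ∧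
      (∀ z₁ ∈ ({z : ℂ | 1 < z.re} \ (↑({(3 : ℂ) / 2} : Finset ℂ) : Set ℂ)), ∀ K : Set (quasiSplit (↥(maximalRealSubfield L)) L (IsCMField.complexConj L) 3).Adelic, IsCompact K →
        ∃ V ∈ 𝓝 z₁, ∃ M : ℝ, ∀ z ∈ V, ∀ g ∈ K, ‖Ec z g‖ ≤ M) := by
  haveI : LocallyCompactSpace (quasiSplit (↥(maximalRealSubfield L)) L (IsCMField.complexConj L) 3).Adelic :=
    inferInstanceAs (LocallyCompactSpace (adelic (↥(maximalRealSubfield L)) L (IsCMField.complexConj L) 3 ((StdForm.antidiagonal 3).over L)))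
  have h32 : ∀ z : ℂ, z ∈ ({z : ℂ | 1 < z.re} \ (↑({(3 : ℂ) / 2} : Finset ℂ) : Set ℂ)) → 1 < z.re ∧ z ≠ (3 : ℂ) / 2 := fun z hz =>
    ⟨hz.1, fun h => hz.2 (by rw [h]; simp)⟩
  -- at a candidate pole of the slit plane: analyticity of every `Ec · g` there (normal form + the bound with `K := {g}`)
  have hanP : ∀ z₁ ∈ P, 1 < z₁.re → z₁ ≠ (3 : ℂ) / 2 → ∀ g, AnalyticAt ℂ (fun z => Ec z g) z₁ := fun z₁ hz₁P hz₁ hz₁' g => by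
    obtain ⟨C, hC⟩ := hbddPK z₁ hz₁P hz₁ hz₁' {g} isCompact_singleton
    exact ((hEnf g) (mem_univ z₁)).analyticAt_of_eventually_norm_le ⟨C, hC.mono fun z hz => hz g rfl⟩
  refine ⟨fun z₁ hz₁ => ?_, fun z₁ hz₁ K hK => ?_⟩
  · obtain ⟨hz₁, hz₁'⟩ := h32 z₁ hz₁
    by_cases hz₁P : z₁ ∈ P
    · refine continuous_at_removable_of_joint_bound Ec (hanP z₁ hz₁P hz₁ hz₁') ((hPcd z₁).mono fun z hzP => ⟨fun g => (hEan g z hzP).differentiableAt, hE4 z hzP⟩)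
        fun K hK => hbddPK z₁ hz₁P hz₁ hz₁' K hK
    · exact hE4 z₁ hz₁P
  · obtain ⟨hz₁, hz₁'⟩ := h32 z₁ hz₁
    by_cases hz₁P : z₁ ∈ P
    · exact locally_bounded_at_removable_of_joint_bound Ec (fun g _ => (hanP z₁ hz₁P hz₁ hz₁' g).continuousAt) (hbddPK z₁ hz₁P hz₁ hz₁' K hK)
    · exact hEbd z₁ hz₁P K hK

/-- **★ p863385's ROW (i) AT `Sp := {3∕2}`, OF THE TWO LETTERS** (HEAD): for the exported continuation `Ec` of a pair-section Eisenstein family (clauses `hEnf hPcd hEan hE4 hEbd` of ★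
`chiEisenstein_meromorphic_exports_level_cm_three_with_bound` ∕ ★ `chiPair_exports_of_witness` + `meromorphicNFOn_twist`), the JOINT removability letter (B-P-K) and the simple-pole
letter (B-3∕2) give ALL of `hSp`, `hEd`, `hF`, `hFE`, `hE4`, `hEbd` of ★ `resGMidBlock_ne_bot_assembly` with `Sp := {3∕2}` (`hE2` is the exports' tube clause, unchanged: `Ec` is not
redefined).  After this file the (V) road's row (i) = ★ modulo {(B-P-K), (B-3∕2)} = ★ modulo {(a′) `L²`→pointwise (S–M), (MS-P′) off-axis (M), R7₃ on-axis (L), (MS-3∕2) ★-composition}.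
[cite: MoeglinWaldspurger1995, IV.1.9–IV.1.11, IV.3.12] [cite: BernsteinLapid2019, Thm 2.3, §4 p. 10] [cite: Langlands1976, §7] -/
theorem chiEisenstein_poleLedger_rows_cm_three_of_letters
    (Ec : ℂ → (quasiSplit (↥(maximalRealSubfield L)) L (IsCMField.complexConj L) 3).Adelic → ℂ) (P : Set ℂ)
    (hEnf : ∀ g, MeromorphicNFOn (fun z => Ec z g) univ) (hPcd : ∀ z₀ : ℂ, ∀ᶠ s in 𝓝[≠] z₀, s ∉ P)
    (hEan : ∀ g (z : ℂ), z ∉ P → AnalyticAt ℂ (fun z => Ec z g) z) (hE4 : ∀ z : ℂ, z ∉ P → Continuous (Ec z))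
    (hEbd : ∀ z₁ : ℂ, z₁ ∉ P → ∀ K : Set (quasiSplit (↥(maximalRealSubfield L)) L (IsCMField.complexConj L) 3).Adelic, IsCompact K → ∃ V ∈ 𝓝 z₁, ∃ M : ℝ, ∀ z ∈ V, ∀ g ∈ K, ‖Ec z g‖ ≤ M)
    (hbddPK : ∀ z₀ ∈ P, 1 < z₀.re → z₀ ≠ (3 : ℂ) / 2 → ∀ K : Set (quasiSplit (↥(maximalRealSubfield L)) L (IsCMField.complexConj L) 3).Adelic, IsCompact K →
      ∃ C : ℝ, ∀ᶠ z in 𝓝[≠] z₀, ∀ g ∈ K, ‖Ec z g‖ ≤ C)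
    (hbdd32 : ∀ g, ∃ C : ℝ, ∀ᶠ z in 𝓝[≠] ((3 : ℂ) / 2), ‖(z - (3 : ℂ) / 2) * Ec z g‖ ≤ C) :
    (∀ s ∈ (({(3 : ℂ) / 2} : Finset ℂ)), s.im = 0 ∧ 1 < s.re ∧ s.re ≤ 2) ∧
      (∀ g, DifferentiableOn ℂ (fun z => Ec z g) ({z : ℂ | 1 < z.re} \ (↑({(3 : ℂ) / 2} : Finset ℂ) : Set ℂ))) ∧
      (∀ z ∈ ({z : ℂ | 1 < z.re} \ (↑({(3 : ℂ) / 2} : Finset ℂ) : Set ℂ)), Continuous (Ec z)) ∧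
      (∀ z₁ ∈ ({z : ℂ | 1 < z.re} \ (↑({(3 : ℂ) / 2} : Finset ℂ) : Set ℂ)), ∀ K : Set (quasiSplit (↥(maximalRealSubfield L)) L (IsCMField.complexConj L) 3).Adelic, IsCompact K →
        ∃ V ∈ 𝓝 z₁, ∃ M : ℝ, ∀ z ∈ V, ∀ g ∈ K, ‖Ec z g‖ ≤ M) ∧
      ∃ Fp : (quasiSplit (↥(maximalRealSubfield L)) L (IsCMField.complexConj L) 3).Adelic → ℂ → ℂ,
        (∀ g, AnalyticAt ℂ (Fp g) ((3 : ℂ) / 2)) ∧ (∀ g, Fp g =ᶠ[𝓝[≠] ((3 : ℂ) / 2)] fun z => (z - (3 : ℂ) / 2) * Ec z g) := by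
  obtain ⟨hSp, hEd, hFp⟩ := chiEisenstein_poleLedger_cm_three_of_letters L Ec P hEnf hEan (fun g z₀ hz₀P hz₀ hz₀' => by
    obtain ⟨C, hC⟩ := hbddPK z₀ hz₀P hz₀ hz₀' {g} isCompact_singleton
    exact ⟨C, hC.mono fun z hz => hz g rfl⟩) hbdd32
  obtain ⟨hE4', hEbd'⟩ := chiEisenstein_jointRows_cm_three_of_letters L Ec P hEnf hPcd hEan hE4 hEbd hbddPK
  exact ⟨hSp, hEd, hE4', hEbd', hFp⟩

end Rows


end Summit.HodgeConjecture.HodgeConjecture.Cruxes.H413.K2E1ChiEisensteinPoleLedgerCMThree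

end
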